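import Mathlib.Algebra.Order.BigOperators.Group.Finset
import Mathlib.Algebra.BigOperators.Ring.Finset
import Mathlib.Data.Real.Basic
import Mathlib.Order.Monotone.Basic
import Mathlib.Tactic.Linarith
import Mathlib.Tactic.Ring
import HarnessLib

/-!
# `NoHeavyLowerTail` (crux stmt-CriticalPhenomena-4575), P2 — the ANTIPODAL REDUCTION: the box lemma `AL` follows from the matching lemma `M′`

Memo SAHI-ROUTE.md §4.30 / `G3-REDUCTIONS-PROOFS.md` (seat `prim-masterthm-p2`, gen 9; `--supports stmt-CriticalPhenomena-4575`).
No `sorry`, standard axioms.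

CONTEXT.  The one missing lemma behind THEOREM B of §4.29 (the hybrid certificate for Kahn's `C_3` on cubes) is the Φ-positivity
statement `G3`: on a cube `γ` with a product weight, for `F > 0` increasing, a ratio `r : γ → [0,1]` with the STAR condition
`F c' ≤ (1 − r c + r c') F c` (`c' ≤ c`), and increasing `g, H, Y ≥ 0` with `F·H ≤ Y`:
`E[g(2−r)Y] − E[F]·E[gH] − E[g]·E[(1−r)Y] ≥ 0`.  Writing this as a double sum `Σ_{x,y} w_x w_y T(x,y)` and grouping the pairs
`(x,y)` into orbits of the coordinate swaps `x_i ↔ y_i` (which preserve `w_x w_y`), `G3` reduces to the weight-free BOX LEMMA `AL`: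
on a Boolean box with complement `cpl`,  `Σ_u g_u[(2−r_u)Y_u − F_{cpl u}H_u − (1−r_{cpl u})Y_{cpl u}] ≥ 0`.
THIS FILE proves the purely algebraic step `AL ⟸ M′` of §4.30(c): if `v` is any injection on the support `U` of `g = 1_U` with the
same image as `cpl` (`U.image v = U.image cpl`) and `v u ≤ u` for all `u ∈ U`, then
  `Σ_{u∈U} [(2−r_u)Y_u − F_{cpl u}H_u − (1−r_{cpl u})Y_{cpl u}]  =  Σ_{u∈U} margin(u, v u) + Σ_{u∈U} (F_{v u} − F_{cpl u})·H_u`,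
where `margin(u,x) := (2−r_u)Y_u − (1−r_x)Y_x − F_x H_u ≥ 0` whenever `x ≤ u` (`margin_nonneg`, from STAR, `F H ≤ Y` and
monotonicity).  Hence `AL` holds for `g = 1_U` as soon as SOME comparable matching `v` has `Σ_{u∈U}(F_{v u} − F_{cpl u})H_u ≥ 0` —
the σ-free, Y-free matching lemma `M′` of §4.30 (OPEN in general; verified by exact LP for all up-sets of `{0,1}^k`, `k ≤ 4`,
and sampled at `k = 5`; PROVED for principal `U` — hence `G3` for 'cumulative' `g` — and for `U = 2^[k]`).
Everything here is stated for an arbitrary finite preorder `P`, an arbitrary "antipode" `cpl : P → P` and finset `U`; no lattice,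
weight or cube structure is needed for this step.
-/

noncomputable section

open scoped Classical

namespace Summit.CriticalPhenomena.PercolationContinuityZ3.Theorems

namespace SahiSharedCube

open Finset

variable {P : Type}

/-- The margin `margin(u,x) = (2 − r u)·Y u − (1 − r x)·Y x − F x · H u` of §4.30 (ratio convention `r = 1 − σ`). [this work] -/
def margin (F H Y r : P → ℝ) (u x : P) : ℝ :=
  (2 - r u) * Y u - (1 - r x) * Y x - F x * H u

/-- **Margin inequality.**  For `x ≤ u`: `(2−r_u)Y_u − (1−r_x)Y_x − F_x H_u ≥ 0`, from `Y` monotone, `0 ≤ r ≤ 1`, `F_u H_u ≤ Y_u`,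
`H_u ≥ 0` and the STAR inequality `F_x ≤ (1 − r_u + r_x) F_u`. [this work] -/
theorem margin_nonneg [Preorder P] {F H Y r : P → ℝ} (hY : Monotone Y) (hH0 : ∀ c, 0 ≤ H c) (hFH : ∀ c, F c * H c ≤ Y c)
    (hr0 : ∀ c, 0 ≤ r c) (hr1 : ∀ c, r c ≤ 1) (hstar : ∀ c c', c' ≤ c → F c' ≤ (1 - r c + r c') * F c)
    {u x : P} (hxu : x ≤ u) : 0 ≤ margin F H Y r u x := by
  unfold margin
  have hYxu : Y x ≤ Y u := hY hxu
  have hc : 0 ≤ 1 - r u + r x := by linarith [hr1 u, hr0 x]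
  have m1 : (1 - r x) * Y x ≤ (1 - r x) * Y u := mul_le_mul_of_nonneg_left hYxu (by linarith [hr1 x])
  have m2 : (1 - r u + r x) * (F u * H u) ≤ (1 - r u + r x) * Y u := mul_le_mul_of_nonneg_left (hFH u) hc
  have m3 : F x * H u ≤ (1 - r u + r x) * F u * H u := mul_le_mul_of_nonneg_right (hstar u x hxu) (hH0 u)
  nlinarith [m1, m2, m3]

/-- The antipodal box sum of `AL` for the indicator `g = 1_U`: `Σ_{u∈U} [(2−r_u)Y_u − F_{cpl u}H_u − (1−r_{cpl u})Y_{cpl u}]`. [this work] -/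
def antipodalSum (F H Y r : P → ℝ) (cpl : P → P) (U : Finset P) : ℝ :=
  ∑ u ∈ U, ((2 - r u) * Y u - F (cpl u) * H u - (1 - r (cpl u)) * Y (cpl u))

/-- Re-indexing: if `v` and `cpl` are injective on `U` with the same image, then `Σ_{u∈U} φ(cpl u) = Σ_{u∈U} φ(v u)`. [this work] -/
theorem sum_comp_eq_of_image_eq {U : Finset P} {cpl v : P → P} (hc : Set.InjOn cpl U) (hv : Set.InjOn v U)
    (himg : U.image v = U.image cpl) (φ : P → ℝ) : ∑ u ∈ U, φ (cpl u) = ∑ u ∈ U, φ (v u) := by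
  rw [← Finset.sum_image (f := φ) hc, ← himg, Finset.sum_image (f := φ) hv]

/-- **The reduction identity `AL = margins + matching remainder`.**  For any `v` injective on `U` with `U.image v = U.image cpl`:
`antipodalSum = Σ_{u∈U} margin(u, v u) + Σ_{u∈U} (F(v u) − F(cpl u))·H u`. [this work] -/
theorem antipodalSum_eq {F H Y r : P → ℝ} {cpl v : P → P} {U : Finset P} (hc : Set.InjOn cpl U) (hv : Set.InjOn v U)
    (himg : U.image v = U.image cpl) :
    antipodalSum F H Y r cpl U = ∑ u ∈ U, margin F H Y r u (v u) + ∑ u ∈ U, (F (v u) - F (cpl u)) * H u := by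
  unfold antipodalSum margin
  have key := sum_comp_eq_of_image_eq hc hv himg (fun x => (1 - r x) * Y x)
  rw [← Finset.sum_add_distrib]
  have h1 : ∑ u ∈ U, ((2 - r u) * Y u - F (cpl u) * H u - (1 - r (cpl u)) * Y (cpl u)) =
      ∑ u ∈ U, ((2 - r u) * Y u - F (cpl u) * H u) - ∑ u ∈ U, (1 - r (cpl u)) * Y (cpl u) := by
    rw [← Finset.sum_sub_distrib]
  have h2 : ∑ u ∈ U, ((2 - r u) * Y u - (1 - r (v u)) * Y (v u) - F (v u) * H u + (F (v u) - F (cpl u)) * H u) =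
      ∑ u ∈ U, ((2 - r u) * Y u - F (cpl u) * H u) - ∑ u ∈ U, (1 - r (v u)) * Y (v u) := by
    rw [← Finset.sum_sub_distrib]; refine Finset.sum_congr rfl fun u _ => ?_; ring
  rw [h1, h2, key]

/-- **`AL ⟸ M′` (§4.30(c)).**  On a finite preorder with an "antipode" `cpl`, STAR ratio `r`, monotone `Y` with `F·H ≤ Y`, `H ≥ 0`:
if there is a map `v`, injective on `U` with the same image as `cpl` on `U`, with `v u ≤ u` on `U` and
`0 ≤ Σ_{u∈U} (F(v u) − F(cpl u))·H u`, then the antipodal box sum for `g = 1_U` is nonnegative.  (The general increasing `g ≥ 0`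
follows by taking nonnegative combinations of indicators of up-sets; the existence of `v` for every up-set `U` of a Boolean box and
all increasing `F, H ≥ 0` is the open matching lemma `M′`.) [this work] -/
theorem antipodalSum_nonneg_of_matching [Preorder P] {F H Y r : P → ℝ} {cpl v : P → P} {U : Finset P}
    (hY : Monotone Y) (hH0 : ∀ c, 0 ≤ H c) (hFH : ∀ c, F c * H c ≤ Y c) (hr0 : ∀ c, 0 ≤ r c) (hr1 : ∀ c, r c ≤ 1)
    (hstar : ∀ c c', c' ≤ c → F c' ≤ (1 - r c + r c') * F c)
    (hc : Set.InjOn cpl U) (hv : Set.InjOn v U) (himg : U.image v = U.image cpl) (hle : ∀ u ∈ U, v u ≤ u)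
    (hR : 0 ≤ ∑ u ∈ U, (F (v u) - F (cpl u)) * H u) :
    0 ≤ antipodalSum F H Y r cpl U := by
  rw [antipodalSum_eq hc hv himg]
  refine add_nonneg (Finset.sum_nonneg fun u hu => ?_) hR
  exact margin_nonneg hY hH0 hFH hr0 hr1 hstar (hle u hu)

end SahiSharedCube

end Summit.CriticalPhenomena.PercolationContinuityZ3.Theorems
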